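import Summits.CriticalPhenomena.PercolationContinuityZ3.Theorems.PercNearOneGluingNoHeavyLowerTailGZGluing
import HarnessLib

/-!
# `NoHeavyLowerTail` (stmt-CriticalPhenomena-4575) — support file: reachability across a SERIES gluing at a cut vertex
# (prover `prim-ineq-prove-2` gen 11; combinatorial half of the SERIES COMPOSITION LAW, THEOREM-SP.md §2 (SER))

No definitions, no measure theory, no sorries.  Setting: edge sets `E₁` (side of the terminal `a`, vertices in `V₁`) and
`E₂` (side of `b`, vertices in `V₂`) with `V₁ ∩ V₂ ⊆ {m, c}` (`m` the cut vertex, `c` the hub), `a ∉ V₂`, `b ∉ V₁`;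
configurations `ω₁ ⊆ E₁`, `ω₂ ⊆ E₂`.  Writing `x ~ᵢ y` for reachability inside `ωᵢ`:

* `GZSeriesGluing.reach_hub_a_iff` — `a ~ c ↔ a ~₁ c ∨ (a ~₁ m ∧ m ~₂ c)`;
* `GZSeriesGluing.reach_hub_b_iff` — `b ~ c ↔ b ~₂ c ∨ (b ~₂ m ∧ m ~₁ c)`;
* `GZSeriesGluing.reach_off_series_iff` — with the edges at `c` removed, `a ~ b ↔ (a ~₁ m) ∧ (m ~₂ b)`.
All three from `GZGluing.walk_split`.  These are the set identities behind THEOREM S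
(`GZSeriesHub.series_cov_sub_mul_log_le`).
-/

namespace Summit.CriticalPhenomena.PercolationContinuityZ3.Theorems

open Literature.Probability.Percolation

namespace GZSeriesGluing

variable {V : Type*} {E₁ E₂ ω₁ ω₂ : Set (Sym2 V)} {V₁ V₂ : Set V} {a b m c : V}

/-- **`a ~ c` across a series gluing**: `a ~ c ↔ a ~₁ c ∨ (a ~₁ m ∧ m ~₂ c)`. [folklore] -/
theorem reach_hub_a_iff (h₁ : ∀ e ∈ E₁, ∀ z ∈ e, z ∈ V₁) (h₂ : ∀ e ∈ E₂, ∀ z ∈ e, z ∈ V₂)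
    (hS : V₁ ∩ V₂ ⊆ {m, c}) (hω₁ : ω₁ ⊆ E₁) (hω₂ : ω₂ ⊆ E₂) (haV₂ : a ∉ V₂) (ham : a ≠ m) (hac : a ≠ c) :
    (openGraph (ω₁ ∪ ω₂)).Reachable a c ↔
      ((openGraph ω₁).Reachable a c ∨ ((openGraph ω₁).Reachable a m ∧ (openGraph ω₂).Reachable m c)) := by
  constructor
  · rintro ⟨p⟩
    obtain ⟨s, hsS, hside, hchain⟩ := GZGluing.walk_split h₁ h₂ hS hω₁ hω₂ p (by simp)
    -- the first segment is on side 1 (a ∉ V₂)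
    have hside₁ : (openGraph ω₁).Reachable a s := by
      rcases hside with h | h
      · exact h
      · have has : a ≠ s := by
          rintro rfl
          rcases hsS with h' | h'
          · exact ham h'
          · exact hac h'
        exact absurd (GZGluing.mem_of_reachable_ne h₂ hω₂ h has) haV₂
    -- closed set: `m`, and `c` provided `m ~₁ c ∨ m ~₂ c`
    have hcl : ∀ u v, u ∈ ({x | x = m ∨ (x = c ∧ ((openGraph ω₁).Reachable m c ∨ (openGraph ω₂).Reachable m c))} : Set V) →
        (u ∈ ({m, c} : Set V) ∧ v ∈ ({m, c} : Set V) ∧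
          ((openGraph ω₁).Reachable u v ∨ (openGraph ω₂).Reachable u v)) →
        v ∈ ({x | x = m ∨ (x = c ∧ ((openGraph ω₁).Reachable m c ∨ (openGraph ω₂).Reachable m c))} : Set V) := by
      rintro u v hu ⟨-, hv, huv⟩
      rcases hv with rfl | rfl
      · exact Or.inl rfl
      · rcases hu with rfl | ⟨rfl, h⟩
        · exact Or.inr ⟨rfl, huv⟩
        · exact Or.inr ⟨rfl, h⟩
    rcases hsS with rfl | rfl
    · -- s = m
      have hc := GZGluing.reflTransGen_mem hcl hchain (Or.inl rfl)
      rcases hc with h | ⟨-, h | h⟩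
      · exact Or.inl (h ▸ hside₁)
      · exact Or.inl (hside₁.trans h)
      · exact Or.inr ⟨hside₁, h⟩
    · exact Or.inl hside₁
  · rintro (h | ⟨h1, h2⟩)
    · exact h.mono (openGraph_mono Set.subset_union_left)
    · exact (h1.mono (openGraph_mono Set.subset_union_left)).trans (h2.mono (openGraph_mono Set.subset_union_right))

/-- **`b ~ c` across a series gluing**: `b ~ c ↔ b ~₂ c ∨ (b ~₂ m ∧ m ~₁ c)` (the mirror image). [folklore] -/
theorem reach_hub_b_iff (h₁ : ∀ e ∈ E₁, ∀ z ∈ e, z ∈ V₁) (h₂ : ∀ e ∈ E₂, ∀ z ∈ e, z ∈ V₂)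
    (hS : V₁ ∩ V₂ ⊆ {m, c}) (hω₁ : ω₁ ⊆ E₁) (hω₂ : ω₂ ⊆ E₂) (hbV₁ : b ∉ V₁) (hbm : b ≠ m) (hbc : b ≠ c) :
    (openGraph (ω₁ ∪ ω₂)).Reachable b c ↔
      ((openGraph ω₂).Reachable b c ∨ ((openGraph ω₂).Reachable b m ∧ (openGraph ω₁).Reachable m c)) := by
  have hS' : V₂ ∩ V₁ ⊆ {m, c} := by rw [Set.inter_comm]; exact hS
  rw [Set.union_comm]
  exact reach_hub_a_iff h₂ h₁ hS' hω₂ hω₁ hbV₁ hbm hbc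

/-- **`a ~ b off c` across a series gluing**: with the edges at `c` removed, `a ~ b ↔ (a ~₁ m) ∧ (m ~₂ b)`. [folklore] -/
theorem reach_off_series_iff (h₁ : ∀ e ∈ E₁, ∀ z ∈ e, z ∈ V₁) (h₂ : ∀ e ∈ E₂, ∀ z ∈ e, z ∈ V₂)
    (hS : V₁ ∩ V₂ ⊆ {m, c}) (hω₁ : ω₁ ⊆ E₁) (hω₂ : ω₂ ⊆ E₂) (haV₂ : a ∉ V₂) (hbV₁ : b ∉ V₁)
    (ham : a ≠ m) (hac : a ≠ c) (hab : a ≠ b) (hbm : b ≠ m) (hbc : b ≠ c) (hmc : m ≠ c) :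
    (openGraph ((ω₁ ∪ ω₂) \ {e : Sym2 V | c ∈ e})).Reachable a b ↔
      ((openGraph (ω₁ \ {e : Sym2 V | c ∈ e})).Reachable a m ∧
        (openGraph (ω₂ \ {e : Sym2 V | c ∈ e})).Reachable m b) := by
  have hunion : (ω₁ ∪ ω₂) \ {e : Sym2 V | c ∈ e} = (ω₁ \ {e : Sym2 V | c ∈ e}) ∪ (ω₂ \ {e : Sym2 V | c ∈ e}) :=
    Set.union_sdiff_distrib
  rw [hunion]
  have hω₁' : ω₁ \ {e : Sym2 V | c ∈ e} ⊆ E₁ := Set.sdiff_subset.trans hω₁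
  have hω₂' : ω₂ \ {e : Sym2 V | c ∈ e} ⊆ E₂ := Set.sdiff_subset.trans hω₂
  have hS' : V₁ ∩ V₂ ⊆ {m, c, b} := fun z hz => by
    rcases hS hz with h | h
    · exact Or.inl h
    · exact Or.inr (Or.inl h)
  constructor
  · rintro ⟨p⟩
    obtain ⟨s, hsS, hside, hchain⟩ := GZGluing.walk_split h₁ h₂ hS' hω₁' hω₂' p (by simp)
    have has : a ≠ s := by
      rintro rfl
      rcases hsS with h' | h' | h'
      · exact ham h'
      · exact hac h'
      · exact hab h'
    have hside₁ : (openGraph (ω₁ \ {e : Sym2 V | c ∈ e})).Reachable a s := by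
      rcases hside with h | h
      · exact h
      · exact absurd (GZGluing.mem_of_reachable_ne h₂ hω₂' h has) haV₂
    -- s = m
    have hsm : s = m := by
      rcases hsS with h' | h' | h'
      · exact h'
      · subst h'; exact (has (GZGluing.eq_of_reachable_sdiff_hub hside₁.symm)).elim
      · subst h'
        exact absurd (GZGluing.mem_of_reachable_ne h₁ hω₁' hside₁.symm has.symm) hbV₁
    subst hsm
    refine ⟨hside₁, ?_⟩
    -- closed set: `s` (= m), and `b` provided `m ~₂' b`
    have hcl : ∀ u v, u ∈ ({x | x = s ∨ (x = b ∧ (openGraph (ω₂ \ {e : Sym2 V | c ∈ e})).Reachable s b)} : Set V) →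
        (u ∈ ({s, c, b} : Set V) ∧ v ∈ ({s, c, b} : Set V) ∧
          ((openGraph (ω₁ \ {e : Sym2 V | c ∈ e})).Reachable u v ∨
            (openGraph (ω₂ \ {e : Sym2 V | c ∈ e})).Reachable u v)) →
        v ∈ ({x | x = s ∨ (x = b ∧ (openGraph (ω₂ \ {e : Sym2 V | c ∈ e})).Reachable s b)} : Set V) := by
      rintro u v hu ⟨-, hv, huv⟩
      rcases hv with rfl | rfl | rfl
      · exact Or.inl rfl
      · -- a hop into c is impossible off c
        exfalso
        rcases hu with rfl | ⟨rfl, -⟩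
        · rcases huv with h | h
          · exact hmc (GZGluing.eq_of_reachable_sdiff_hub h.symm)
          · exact hmc (GZGluing.eq_of_reachable_sdiff_hub h.symm)
        · rcases huv with h | h
          · exact hbc (GZGluing.eq_of_reachable_sdiff_hub h.symm)
          · exact hbc (GZGluing.eq_of_reachable_sdiff_hub h.symm)
      · rcases hu with rfl | ⟨rfl, h⟩
        · -- hop u = m → b: must be on side 2 (b ∉ V₁)
          rcases huv with h | h
          · exact absurd (GZGluing.mem_of_reachable_ne h₁ hω₁' h.symm hbm) hbV₁
          · exact Or.inr ⟨rfl, h⟩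
        · exact Or.inr ⟨rfl, h⟩
    have hb := GZGluing.reflTransGen_mem hcl hchain (Or.inl rfl)
    rcases hb with h | ⟨-, h⟩
    · exact absurd h hbm
    · exact h
  · rintro ⟨h1, h2⟩
    exact (h1.mono (openGraph_mono Set.subset_union_left)).trans (h2.mono (openGraph_mono Set.subset_union_right))

end GZSeriesGluing

end Summit.CriticalPhenomena.PercolationContinuityZ3.Theorems
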